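import Summits.RiemannHypothesis.RiemannHypothesis.Theorems.MotivicDoorFfThinReader
import Literature.NumberTheory.FaltingsSerre.TypeGCriterionConverse

/-!
# Motivic door, function-field side (C)(i), part 9a: DIMENSION 2 IN CLOSED FORM — the box; `{1,4}` blind, `{1,3,4}` decides
(pub-rhdoor seat ff-1.  HONEST FRAMING: lottery ticket at the motivic door; RH probability negligible; consolation
prizes are real: a new semi-local Weil-positivity theorem, or a located gap in the Connes–Consani programme, plus the
ff-door theorem.  No claim about `ζ`; "RH(q,h)" is `|α| = √q` for the complex roots of ONE integer polynomial `h`.)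

Parts 7a–7c settled which trace readers decide RH at dimension `g` BELOW the handover (exactly the sets
`F ⊇ {1, …, g}`), part 7d showed that above it deciding and certifying part ways, and part 8a that every STRIDE
`{N, 2N, …, gN}` decides.  Which sparse lag sets with far lags (`n > g`) decide was otherwise left OPEN in
FF-DOOR (i).G.  At `g = 2` everything is explicit (PROVED here, [folklore] algebra on top of ONE imported lemma):

* §1 `quartic_honest`, `eq_quartic_of_honest`: the honest data of dimension `2` over `q ≥ 1` are EXACTLY the
  two-parameter family `x^4 + a x^3 + b x^2 + q a x + q^2`, `(a, b) = (c_3, c_2) ∈ ℤ²`.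
* §2 `ffRH_quartic_iff`: RH for that datum ⟺ the BOX `a² - 4b + 8q ≥ 0 ∧ a² ≤ 16q ∧ 2q + b ≥ 0 ∧ 4a²q ≤ (2q + b)²`
  — Rück's lemma as printed in [Maisner–Nart 2002, Lemma 2.1 (i) ⇔ (iii) p. 323], IMPORTED from the Literature
  proof `Literature.NumberTheory.FaltingsSerre.norm_sq_eq_inv_of_surface_root` / `ineq_of_norm_sq_eq_inv`
  (root `α ↦ 1/α`; their `a` is our `-a`), not re-derived.
* §3 `powerSum_quartic`: `s_1 = -a`, `s_2 = a² - 2b`, `s_3 = -a³ + 3ab - 3qa`, `s_4 = a⁴ - 4a²b + 4qa² + 2b² - 4q²`.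
* §4 `traceReader_not_decides_of_lags_zero_one_four` (`q ≥ 2`): NO reader of lags inside `{0, 1, 4}` decides RH
  at dimension `2` — `(a, b) = (1, 2q)` (RH-true) and `(1, 2 - 2q)` (RH-false: `4a²q = 4q > 4 = (2q + b)²`) share
  `s_1 = -1` and `s_4 = (2q - 1)²`.  So `{4}` (the stride `{2N}` without `N`, cf. part 8a) and `{1, 4}` never decide.
* §5 `traceReader_one_three_four_decides` (`q ≥ 1`): the reader "some RH-true honest datum has these
  `K(1), K(3), K(4)`" DECIDES RH at dimension `2`: `s_1, s_3` give `a' = a` and `3a (b' - b) = 0`; if `a = 0`,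
  `s_4` gives `b'² = b²`, and at `a = 0` the box is symmetric under `b ↦ -b`.  A deciding set need NOT contain a
  stride `{N, 2N}` and need NOT pin the datum (`x^4 ± b x^2 + q^2` share all of `K(1), K(3), K(4)`).

DOOR READING ((i).G at `g = 2`).  With far lags allowed, deciding is a property of the lag set finer than
"contains `{1, 2}` or a stride": `{1, 3, 4}` decides for every `q`, `{1, 4}` for none (`q ≥ 2`); part 9b
(`MotivicDoorFfPairLags`) shows `{2, 3}` decides iff `q ∈ {3, 4}` — decidability of a lag set can DEPEND ON `q`.
Nothing here is, or implies, a statement about `ζ`.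
-/

set_option linter.dupNamespace false

noncomputable section

open Polynomial Finset

open Summit.RiemannHypothesis.RiemannHypothesis.Theorems.PfPersistence.FfAngleTwin

namespace Summit.RiemannHypothesis.RiemannHypothesis.Theorems.MotivicDoor.FunctionField

/-- The honest quartic `x^4 + a x^3 + b x^2 + q a x + q^2` over `q` (local notation, no definition). -/
local notation "quart[" q ", " a ", " b "]" =>
  (X ^ 4 + C (a : ℤ) * X ^ 3 + C (b : ℤ) * X ^ 2 + C (((q : ℕ) : ℤ) * (a : ℤ)) * X + C (((q : ℕ) : ℤ) ^ 2) : ℤ[X])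

/-- The RH box of [MN02, Lemma 2.1 (iii)] in integers (local notation, no definition). -/
local notation "box[" q ", " a ", " b "]" =>
  ((0 : ℤ) ≤ (a : ℤ) ^ 2 - 4 * (b : ℤ) + 8 * ((q : ℕ) : ℤ) ∧ (a : ℤ) ^ 2 ≤ 16 * ((q : ℕ) : ℤ) ∧
    (0 : ℤ) ≤ 2 * ((q : ℕ) : ℤ) + (b : ℤ) ∧ 4 * (a : ℤ) ^ 2 * ((q : ℕ) : ℤ) ≤ (2 * ((q : ℕ) : ℤ) + (b : ℤ)) ^ 2)

/-! ## 1. The honest data of dimension 2 are the honest quartics -/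

/-- The coefficients of the honest quartic. -/
theorem quartic_coeff (q : ℕ) (a b : ℤ) :
    (quart[q, a, b]).coeff 0 = (q : ℤ) ^ 2 ∧ (quart[q, a, b]).coeff 1 = (q : ℤ) * a ∧ (quart[q, a, b]).coeff 2 = b ∧
    (quart[q, a, b]).coeff 3 = a ∧ (quart[q, a, b]).coeff 4 = 1 ∧ ∀ n, 5 ≤ n → (quart[q, a, b]).coeff n = 0 := by
  simp only [coeff_add, coeff_X_pow, coeff_C_mul, coeff_X, coeff_C]
  refine ⟨by norm_num, by norm_num, by norm_num, by norm_num, by norm_num, fun n hn => ?_⟩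
  have h4 : n ≠ 4 := by omega
  have h3 : n ≠ 3 := by omega
  have h2 : n ≠ 2 := by omega
  have h1 : (1 : ℕ) ≠ n := by omega
  have h0 : n ≠ 0 := by omega
  simp [h4, h3, h2, h1, h0]

/-- The honest quartic IS an honest datum of dimension `2`: monic, degree `4`, functional equation
`q^2 c_j = q^i c_i` (`i + j = 4`). [folklore] -/
theorem quartic_honest (q : ℕ) (a b : ℤ) :
    (quart[q, a, b]).Monic ∧ (quart[q, a, b]).natDegree = 2 * 2 ∧
    ∀ i j, i + j = 2 * 2 → (q : ℤ) ^ 2 * (quart[q, a, b]).coeff j = (q : ℤ) ^ i * (quart[q, a, b]).coeff i := by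
  obtain ⟨t0, t1, t2, t3, t4, t5⟩ := quartic_coeff q a b
  have hdeg : (quart[q, a, b]).natDegree = 4 := by
    refine le_antisymm ?_ (le_natDegree_of_ne_zero (by rw [t4]; exact one_ne_zero))
    exact (natDegree_le_iff_coeff_eq_zero).2 fun N hN => t5 N (by omega)
  have hmon : (quart[q, a, b]).Monic := by
    rw [Monic, leadingCoeff, hdeg, t4]
  refine ⟨hmon, hdeg, ?_⟩
  intro i j hij
  have hi : i ≤ 4 := by omega
  obtain rfl : j = 4 - i := by omega
  interval_cases i
  · rw [show (4 : ℕ) - 0 = 4 from rfl, t4, t0]; ring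
  · rw [show (4 : ℕ) - 1 = 3 from rfl, t3, t1]; ring
  · rw [show (4 : ℕ) - 2 = 2 from rfl, t2]
  · rw [show (4 : ℕ) - 3 = 1 from rfl, t1, t3]; ring
  · rw [show (4 : ℕ) - 4 = 0 from rfl, t0, t4]; ring

/-- CLASSIFICATION: an honest datum of dimension `2` over `q ≥ 1` IS the honest quartic with `(a, b) = (c_3, c_2)`
(the functional equation at `(1, 3)` gives `c_1 = q c_3`, at `(0, 4)` gives `c_0 = q^2`). [folklore] -/
theorem eq_quartic_of_honest {q : ℕ} (hq : 0 < q) {h : ℤ[X]} (hh : h.Monic) (hdeg : h.natDegree = 2 * 2)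
    (hFE : ∀ i j, i + j = 2 * 2 → (q : ℤ) ^ 2 * h.coeff j = (q : ℤ) ^ i * h.coeff i) :
    h = quart[q, h.coeff 3, h.coeff 2] := by
  have hc4 : h.coeff 4 = 1 := by
    have := hh.coeff_natDegree; rw [hdeg] at this; exact this
  have hc0 : h.coeff 0 = (q : ℤ) ^ 2 := by
    have e := hFE 0 4 (by norm_num); rw [hc4] at e; linear_combination -e
  have hc1 : h.coeff 1 = (q : ℤ) * h.coeff 3 := by
    have e := hFE 1 3 (by norm_num)
    have hq0 : (q : ℤ) ≠ 0 := by exact_mod_cast hq.ne'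
    have : (q : ℤ) * ((q : ℤ) * h.coeff 3 - h.coeff 1) = 0 := by linear_combination e
    rcases mul_eq_zero.1 this with h0 | h0
    · exact absurd h0 hq0
    · linear_combination -h0
  obtain ⟨t0, t1, t2, t3, t4, -⟩ := quartic_coeff q (h.coeff 3) (h.coeff 2)
  obtain ⟨-, hd', -⟩ := quartic_honest q (h.coeff 3) (h.coeff 2)
  refine (Polynomial.ext_iff_natDegree_le (n := 4) (by rw [hdeg]) (by rw [hd'])).2 ?_
  intro i hi
  interval_cases i
  · rw [t0, hc0]
  · rw [t1, hc1]
  · rw [t2]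
  · rw [t3]
  · rw [t4, hc4]

/-! ## 2. RH at dimension 2 is a box (Rück; Maisner–Nart Lemma 2.1), imported -/

/-- RH AT DIMENSION 2 IS A BOX: for `q ≥ 1` and the honest quartic `x^4 + a x^3 + b x^2 + q a x + q^2`,
`(∀ roots α, |α| = √q) ⟺ a² - 4b + 8q ≥ 0 ∧ a² ≤ 16q ∧ 2q + b ≥ 0 ∧ 4a²q ≤ (2q + b)²` — [MN02, Lemma 2.1
(i) ⇔ (iii) p. 323] (after Rück).  IMPORTED, not re-derived: both directions are the Literature theorems
`norm_sq_eq_inv_of_surface_root` / `ineq_of_norm_sq_eq_inv` for the reciprocal polynomial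
`1 + a z + b z² + q a z³ + q² z⁴ = z⁴ · quart(1/z)` (their `a` is our `-a`). [cite: MaisnerNart2002, Lemma 2.1 p. 323] -/
theorem ffRH_quartic_iff {q : ℕ} (hq : 0 < q) (a b : ℤ) :
    (∀ α ∈ frobRoots quart[q, a, b], ‖α‖ = Real.sqrt q) ↔ box[q, a, b] := by
  obtain ⟨hm, -, -⟩ := quartic_honest q a b
  have hne : ((quart[q, a, b]).map (Int.castRingHom ℂ)) ≠ 0 := (hm.map _).ne_zero
  have hqC : (q : ℂ) ≠ 0 := by exact_mod_cast hq.ne'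
  have hmem : ∀ α : ℂ, α ∈ frobRoots quart[q, a, b] ↔
      α ^ 4 + (a : ℂ) * α ^ 3 + (b : ℂ) * α ^ 2 + (q : ℂ) * (a : ℂ) * α + (q : ℂ) ^ 2 = 0 := by
    intro α
    rw [frobRoots, mem_roots hne, IsRoot.def, eval_map]
    simp only [eval₂_add, eval₂_mul, eval₂_pow, eval₂_C, eval₂_X]
    simp only [eq_intCast, Int.cast_mul, Int.cast_pow, Int.cast_natCast]
  constructor
  · intro hR
    have key : ∀ z : ℂ, 1 - ((-a : ℤ) : ℂ) * z + (b : ℂ) * z ^ 2 - (q : ℂ) * ((-a : ℤ) : ℂ) * z ^ 3 +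
        (q : ℂ) ^ 2 * z ^ 4 = 0 → ‖z‖ ^ 2 = (q : ℝ)⁻¹ := by
      intro z hz
      have hz0 : z ≠ 0 := by
        rintro rfl; norm_num at hz
      have hroot : (z⁻¹) ^ 4 + (a : ℂ) * (z⁻¹) ^ 3 + (b : ℂ) * (z⁻¹) ^ 2 + (q : ℂ) * (a : ℂ) * z⁻¹ + (q : ℂ) ^ 2
          = 0 := by
        have e : (z⁻¹) ^ 4 + (a : ℂ) * (z⁻¹) ^ 3 + (b : ℂ) * (z⁻¹) ^ 2 + (q : ℂ) * (a : ℂ) * z⁻¹ + (q : ℂ) ^ 2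
            = (z⁻¹) ^ 4 * (1 - ((-a : ℤ) : ℂ) * z + (b : ℂ) * z ^ 2 - (q : ℂ) * ((-a : ℤ) : ℂ) * z ^ 3 +
              (q : ℂ) ^ 2 * z ^ 4) := by
          push_cast
          field_simp
          ring
        rw [e, hz, mul_zero]
      have hn := hR _ ((hmem _).2 hroot)
      rw [norm_inv] at hn
      have hz' : ‖z‖ = (Real.sqrt q)⁻¹ := by rw [← hn, inv_inv]
      rw [hz', inv_pow, Real.sq_sqrt (Nat.cast_nonneg q)]
    have := Literature.NumberTheory.FaltingsSerre.ineq_of_norm_sq_eq_inv hq key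
    simpa only [neg_sq] using this
  · rintro ⟨h₁, h₂, h₃, h₄⟩ α hα
    have hroot := (hmem α).1 hα
    have hα0 : α ≠ 0 := by
      rintro rfl
      have h0 : (q : ℂ) ^ 2 = 0 := by simpa using hroot
      exact hqC (pow_eq_zero_iff (n := 2) (by norm_num) |>.1 h0)
    have hz : 1 - ((-a : ℤ) : ℂ) * α⁻¹ + (b : ℂ) * (α⁻¹) ^ 2 - (q : ℂ) * ((-a : ℤ) : ℂ) * (α⁻¹) ^ 3 +
        (q : ℂ) ^ 2 * (α⁻¹) ^ 4 = 0 := by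
      have e : 1 - ((-a : ℤ) : ℂ) * α⁻¹ + (b : ℂ) * (α⁻¹) ^ 2 - (q : ℂ) * ((-a : ℤ) : ℂ) * (α⁻¹) ^ 3 +
          (q : ℂ) ^ 2 * (α⁻¹) ^ 4
          = (α⁻¹) ^ 4 * (α ^ 4 + (a : ℂ) * α ^ 3 + (b : ℂ) * α ^ 2 + (q : ℂ) * (a : ℂ) * α + (q : ℂ) ^ 2) := by
        push_cast
        field_simp
        ring
      rw [e, hroot, mul_zero]
    have hsq := Literature.NumberTheory.FaltingsSerre.norm_sq_eq_inv_of_surface_root hq (a := -a) (b := b)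
      (by rwa [neg_sq]) (by rwa [neg_sq]) h₃ (by rwa [neg_sq]) hz
    rw [norm_inv, inv_pow, inv_inj] at hsq
    rw [← Real.sqrt_sq (norm_nonneg α), hsq]

/-! ## 3. The first four power sums of the honest quartic -/

/-- The pairs `(i, j)` with `i + j = 4`, `i, j ≥ 1`: `(1,3), (2,2), (3,1)`. -/
private theorem antidiag_filter_four :
    ((antidiagonal 4).filter (fun a : ℕ × ℕ => 0 < a.1 ∧ 0 < a.2)) = {(1, 3), (2, 2), (3, 1)} := by decide

/-- `s_4 = -4 c_0 - (c_3 s_3 + c_2 s_2 + c_1 s_1)` for a monic quartic (top-indexed Newton of part 7a at `n = 4`).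
[folklore] -/
theorem powerSum_four_of_natDegree_four {h : ℤ[X]} (hh : h.Monic) (hdeg : h.natDegree = 4) :
    powerSum (frobRoots h) 4 = -(4 * (h.coeff 0 : ℂ)) -
      ((h.coeff 3 : ℂ) * powerSum (frobRoots h) 3 + (h.coeff 2 : ℂ) * powerSum (frobRoots h) 2 +
        (h.coeff 1 : ℂ) * powerSum (frobRoots h) 1) := by
  have h4 := powerSum_frobRoots_newton hh (n := 4) (by norm_num) hdeg.ge
  have n1 : ((1 : ℕ), (3 : ℕ)) ∉ ({(2, 2), (3, 1)} : Finset (ℕ × ℕ)) := by decide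
  have n2 : ((2 : ℕ), (2 : ℕ)) ∉ ({(3, 1)} : Finset (ℕ × ℕ)) := by decide
  rw [hdeg, antidiag_filter_four, sum_insert n1, sum_insert n2, sum_singleton] at h4
  norm_num at h4
  rw [h4]; ring

/-- THE POWER SUMS OF THE HONEST QUARTIC: `s_1 = -a`, `s_2 = a² - 2b`, `s_3 = -a³ + 3ab - 3qa`,
`s_4 = a⁴ - 4a²b + 4qa² + 2b² - 4q²`. [folklore] -/
theorem powerSum_quartic (q : ℕ) (a b : ℤ) :
    powerSum (frobRoots quart[q, a, b]) 1 = ((-a : ℤ) : ℂ) ∧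
    powerSum (frobRoots quart[q, a, b]) 2 = ((a ^ 2 - 2 * b : ℤ) : ℂ) ∧
    powerSum (frobRoots quart[q, a, b]) 3 = ((-a ^ 3 + 3 * a * b - 3 * q * a : ℤ) : ℂ) ∧
    powerSum (frobRoots quart[q, a, b]) 4 =
      ((a ^ 4 - 4 * a ^ 2 * b + 4 * q * a ^ 2 + 2 * b ^ 2 - 4 * q ^ 2 : ℤ) : ℂ) := by
  obtain ⟨t0, t1, t2, t3, -, -⟩ := quartic_coeff q a b
  obtain ⟨hm, hd, -⟩ := quartic_honest q a b
  obtain ⟨h1, h2, h3⟩ := powerSum_le_three_of_natDegree_four hm hd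
  have h4 := powerSum_four_of_natDegree_four hm hd
  rw [t3] at h1
  rw [t3, t2] at h2
  rw [t3, t2, t1] at h3
  rw [t0, t1, t2, t3, h1, h2, h3] at h4
  refine ⟨by rw [h1]; push_cast; ring, by rw [h2]; push_cast; ring, by rw [h3]; push_cast; ring, ?_⟩
  rw [h4]; push_cast; ring

/-! ## 4. `{0, 1, 4}` is blind at dimension 2 -/

/-- FF-DOOR (i).G at `g = 2`, A BLIND FAR LAG (`q ≥ 2`): NO trace reader of lags inside `{0, 1, 4}` decides RH at
dimension `2` — hence neither `{4}` (the stride `{2N}` without `N`; part 8a needs the full stride), nor `{1, 4}`,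
nor `{0, 1, 4}`.  Witness pair: `(a, b) = (1, 2q)` is RH-true, `(1, 2 - 2q)` is RH-false (`4a²q = 4q > 4 = (2q + b)²`),
and they share `K(0) = 2`, `s_1 = -1`, `s_4 = (2q - 1)²`. [folklore] -/
theorem traceReader_not_decides_of_lags_zero_one_four {q : ℕ} (hq : 2 ≤ q) {F : Set ℕ}
    (hF : ∀ n ∈ F, n = 0 ∨ n = 1 ∨ n = 4) :
    ¬ ∃ Φ : Tower → Prop,
      (∀ T T' : Tower, (∀ n ∈ F, T n 0 (Fin.last n) = T' n 0 (Fin.last n)) → Φ T → Φ T') ∧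
      ∀ h : ℤ[X], h.Monic → h.natDegree = 2 * 2 →
        (∀ i j, i + j = 2 * 2 → (q : ℤ) ^ 2 * h.coeff j = (q : ℤ) ^ i * h.coeff i) →
        (Φ (weilWindowTower (q : ℝ) h) ↔ ∀ α ∈ frobRoots h, ‖α‖ = Real.sqrt q) := by
  rintro ⟨Φ, hloc, hdec⟩
  have hq0 : 0 < q := by omega
  have hqR : (0 : ℝ) < q := by exact_mod_cast hq0
  have hqZ : (2 : ℤ) ≤ q := by exact_mod_cast hq
  obtain ⟨hmP, hdP, hfeP⟩ := quartic_honest q 1 (2 * q)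
  obtain ⟨hmN, hdN, hfeN⟩ := quartic_honest q 1 (2 - 2 * q)
  obtain ⟨sP1, -, -, sP4⟩ := powerSum_quartic q 1 (2 * q)
  obtain ⟨sN1, -, -, sN4⟩ := powerSum_quartic q 1 (2 - 2 * q)
  have hRP : ∀ α ∈ frobRoots quart[q, (1 : ℤ), (2 * q : ℤ)], ‖α‖ = Real.sqrt q := by
    refine (ffRH_quartic_iff hq0 1 (2 * q)).2 ⟨?_, ?_, ?_, ?_⟩ <;> nlinarith
  have hΦP := (hdec _ hmP hdP hfeP).2 hRP
  have hcorner : ∀ n ∈ F, weilWindowTower (q : ℝ) quart[q, (1 : ℤ), (2 * q : ℤ)] n 0 (Fin.last n) =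
      weilWindowTower (q : ℝ) quart[q, (1 : ℤ), (2 - 2 * q : ℤ)] n 0 (Fin.last n) := by
    intro n hn
    rcases hF n hn with rfl | rfl | rfl
    · exact corner_zero_eq_of_natDegree_eq (q : ℝ) hmP hmN (hdP.trans hdN.symm)
    · exact (corner_eq_iff_powerSum_eq hqR _ _ 1).2 (by rw [sP1, sN1])
    · exact (corner_eq_iff_powerSum_eq hqR _ _ 4).2 (by rw [sP4, sN4]; push_cast; ring)
  have hRN := (hdec _ hmN hdN hfeN).1 (hloc _ _ hcorner hΦP)
  obtain ⟨-, -, -, h4⟩ := (ffRH_quartic_iff hq0 1 (2 - 2 * q)).1 hRN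
  nlinarith

/-- In particular the single far lag `{4}` does not decide RH at dimension `2` (`q ≥ 2`): a stride `{N, 2N}` decides
(part 8a), its top lag alone does not. [folklore] -/
theorem traceReader_four_not_decides {q : ℕ} (hq : 2 ≤ q) :
    ¬ ∃ Φ : Tower → Prop,
      (∀ T T' : Tower, (∀ n ∈ ({4} : Set ℕ), T n 0 (Fin.last n) = T' n 0 (Fin.last n)) → Φ T → Φ T') ∧
      ∀ h : ℤ[X], h.Monic → h.natDegree = 2 * 2 →
        (∀ i j, i + j = 2 * 2 → (q : ℤ) ^ 2 * h.coeff j = (q : ℤ) ^ i * h.coeff i) →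
        (Φ (weilWindowTower (q : ℝ) h) ↔ ∀ α ∈ frobRoots h, ‖α‖ = Real.sqrt q) :=
  traceReader_not_decides_of_lags_zero_one_four hq fun n hn => by
    rw [Set.mem_singleton_iff] at hn; omega

/-! ## 5. `{1, 3, 4}` decides at dimension 2 -/

/-- FF-DOOR (i).G at `g = 2`, A DECIDING SET WITH NO STRIDE AND NO PINNING (`q ≥ 1`): the `{1, 3, 4}`-trace-local
reader "some RH-true honest datum of dimension `2` over `q` has these `K(1), K(3), K(4)`" DECIDES RH at dimension
`2`.  (`s_1, s_3` give `a' = a` and `3a (b' - b) = 0`; when `a = 0`, `s_4` gives `b'² = b²`, and at `a = 0` the box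
of §2 is symmetric under `b ↦ -b`.)  Contrast §4 (`{1, 4}`: never) and part 7c (`{1, 2}`: decides by pinning):
`{1, 3, 4}` decides WITHOUT pinning (`x^4 ± b x^2 + q^2` share `K(1), K(3), K(4)`). [folklore] -/
theorem traceReader_one_three_four_decides {q : ℕ} (hq : 0 < q) :
    ∃ Φ : Tower → Prop,
      (∀ T T' : Tower, (∀ n ∈ ({1, 3, 4} : Set ℕ), T n 0 (Fin.last n) = T' n 0 (Fin.last n)) → Φ T → Φ T') ∧
      ∀ h : ℤ[X], h.Monic → h.natDegree = 2 * 2 →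
        (∀ i j, i + j = 2 * 2 → (q : ℤ) ^ 2 * h.coeff j = (q : ℤ) ^ i * h.coeff i) →
        (Φ (weilWindowTower (q : ℝ) h) ↔ ∀ α ∈ frobRoots h, ‖α‖ = Real.sqrt q) := by
  have hqR : (0 : ℝ) < q := by exact_mod_cast hq
  refine ⟨fun T => ∃ a b : ℤ, box[q, a, b] ∧
      ∀ n ∈ ({1, 3, 4} : Set ℕ), T n 0 (Fin.last n) = weilWindowTower (q : ℝ) quart[q, a, b] n 0 (Fin.last n),
    ?_, ?_⟩
  · rintro T T' hTT' ⟨a, b, hbox, htr⟩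
    exact ⟨a, b, hbox, fun n hn => (hTT' n hn).symm.trans (htr n hn)⟩
  · intro h hh hdeg hFE
    obtain ⟨a₀, b₀, rfl⟩ : ∃ a₀ b₀ : ℤ, h = quart[q, a₀, b₀] := ⟨_, _, eq_quartic_of_honest hq hh hdeg hFE⟩
    constructor
    · rintro ⟨a, b, hbox, htr⟩
      obtain ⟨s1, -, s3, s4⟩ := powerSum_quartic q a₀ b₀
      obtain ⟨t1, -, t3, t4⟩ := powerSum_quartic q a b
      have e1 := (corner_eq_iff_powerSum_eq hqR _ _ 1).1 (htr 1 (by simp))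
      have e3 := (corner_eq_iff_powerSum_eq hqR _ _ 3).1 (htr 3 (by simp))
      have e4 := (corner_eq_iff_powerSum_eq hqR _ _ 4).1 (htr 4 (by simp))
      rw [s1, t1] at e1
      rw [s3, t3] at e3
      rw [s4, t4] at e4
      have E1 : (-a₀ : ℤ) = -a := by exact_mod_cast e1
      have E3 : (-a₀ ^ 3 + 3 * a₀ * b₀ - 3 * q * a₀ : ℤ) = -a ^ 3 + 3 * a * b - 3 * q * a := by
        exact_mod_cast e3
      have E4 : (a₀ ^ 4 - 4 * a₀ ^ 2 * b₀ + 4 * q * a₀ ^ 2 + 2 * b₀ ^ 2 - 4 * q ^ 2 : ℤ) =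
          a ^ 4 - 4 * a ^ 2 * b + 4 * q * a ^ 2 + 2 * b ^ 2 - 4 * q ^ 2 := by
        exact_mod_cast e4
      obtain rfl : a = a₀ := by omega
      refine (ffRH_quartic_iff hq a b₀).2 ?_
      have h3 : 3 * a * (b₀ - b) = 0 := by linear_combination E3
      rcases mul_eq_zero.1 h3 with h0 | h0
      · obtain rfl : a = 0 := by omega
        have hb2 : 2 * ((b₀ - b) * (b₀ + b)) = 0 := by linear_combination E4
        rcases mul_eq_zero.1 ((mul_eq_zero.1 hb2).resolve_left (by norm_num)) with hb0 | hb0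
        · obtain rfl : b₀ = b := by omega
          exact hbox
        · obtain rfl : b₀ = -b := by omega
          obtain ⟨i1, i2, i3, i4⟩ := hbox
          exact ⟨by linarith, by linarith, by linarith, by nlinarith [sq_nonneg (2 * (q : ℤ) + -b)]⟩
      · obtain rfl : b₀ = b := by omega
        exact hbox
    · intro hR
      exact ⟨a₀, b₀, (ffRH_quartic_iff hq a₀ b₀).1 hR, fun n _ => rfl⟩

end Summit.RiemannHypothesis.RiemannHypothesis.Theorems.MotivicDoor.FunctionField

end
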